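import Literature.Geometry.Lorentzian.DevelopmentImmersionInjective
import Literature.Geometry.Lorentzian.CauchyDevelopmentRestrict
import HarnessLib

/-!
# The isometric immersion of a common globally hyperbolic development is an open embedding
# (Sbierski 2016, §3.1, Lemma 9, for developments realised as open subsets)

J. Sbierski, *On the existence of a maximal Cauchy development for the Einstein equations: a
dezornification*, Ann. Henri Poincaré 17 (2016) = arXiv:1309.7591, §3.1, Lemma 9 (arXiv
numbering): *"Say `(M, g)` and `(M', g')` are two globally hyperbolic spacetimes with Cauchy
surfaces `Σ` and `Σ'`, respectively. Let `ψ : M → M'` be an isometric immersion such that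
`ψ|_Σ : Σ → Σ'` is a diffeomorphism. Then `ψ` is an isometric embedding."* The tree's
`CauchyDevelopment.injective_of_isIsometricImmersion` (`DevelopmentImmersionInjective`) proves
this for two Cauchy developments `𝒟`, `𝒟'` of the same data. In the construction of the maximal
common globally hyperbolic development and of the common extension (Thm. 10, Thm. 5), however,
the lemma is applied to the open sub-spacetimes `U ⊆ M` — *"Note that by Lemma 9 `ψ` is then
automatically an isometric embedding"* (proof of Thm. 10) — which are developments
`(U, g|_U, τ|_U, ι)` without being terms of the structure `CauchyDevelopment` (that would require
the normal field of `𝒟` as a smooth datum). This file proves the lemma in that form: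

* `CauchyDevelopment.injective_of_isIsometricImmersion_opens` — for an open `U ⊇ ι(X)` of the
  spacetime of a Cauchy development `𝒟` in which `ι(X)` is a Cauchy hypersurface, a
  time-orientation preserving isometric immersion `ψ : (U, g|_U, τ|_U) → M'` into a Cauchy
  development `𝒟'` of the same data with `ψ ∘ ι = ι'` is injective;
* `CauchyDevelopment.isOpenEmbedding_of_isIsometricImmersion_opens` — hence an open embedding
  (it is a local diffeomorphism, `LorentzianMetric.isLocalDiffeomorph_of_isIsometricImmersion`,
  by the inverse function theorem `Literature.Geometry.Manifold.isLocalDiffeomorphAt_of_mfderiv`).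

The proof is that of `DevelopmentImmersionInjective` verbatim (integral curves of the pulled-back
orienting field `Y = ψ^* T'` in place of the printed timelike geodesics), run on the manifold `U`;
its pointwise ingredients are first restated for an isometric immersion between ARBITRARY
equidimensional time-oriented Lorentzian manifolds (`LorentzianMetric.isInvertible_mfderiv_of_isIsometricImmersion`,
`….mfderiv_mpullback_vectorField`, `….isTimelike_mpullback_vectorField`,
`TimeOrientation.isFutureDirected_mpullback_vectorField`, `….contMDiff_mpullback_vectorField`,
`….isMIntegralCurveAt_comp_of_mpullback`), the `DataEmbedding` versions of that file being their
special cases.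

All results proved; no definitions, no named facts (D-0026).

## References

* J. Sbierski, Ann. Henri Poincaré 17 (2016) 301–329 = arXiv:1309.7591v3, §3.1, Lemma 9 and
  the proof of Thm. 10; §2, remark after Def. 2.3.
* B. O'Neill, *Semi-Riemannian geometry with applications to relativity*, 1983, Ch. 3, p. 58
  and p. 90 (isometric immersions between equidimensional manifolds are local isometries),
  Ch. 14, Lemma 14.29 and Prop. 14.31.
-/

noncomputable section

open Bundle Set Function Filter TopologicalSpace Topology VectorField
open scoped Manifold ContDiff Topology

namespace Literature.Geometry.Lorentzian

universe u

/-! ### Isometric immersions between equidimensional time-oriented Lorentzian manifolds -/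

section Generic

variable {d : ℕ} {M : Type*} [TopologicalSpace M] [ChartedSpace (EuclideanSpace ℝ (Fin d)) M]
  [IsManifold (𝓡 d) ∞ M] {M' : Type*} [TopologicalSpace M']
  [ChartedSpace (EuclideanSpace ℝ (Fin d)) M'] [IsManifold (𝓡 d) ∞ M']
  {g : LorentzianMetric (𝓡 d) ∞ M} {g' : LorentzianMetric (𝓡 d) ∞ M'} {ψ : M → M'}

namespace LorentzianMetric

/-- **The differential of an isometric immersion between equidimensional Lorentzian manifolds is
invertible** (injective by nondegeneracy, onto by dimension). O'Neill 1983, Ch. 3, p. 58.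
[cite: ONeillSemiRiemannian1983, Ch. 3, p. 58] -/
theorem isInvertible_mfderiv_of_isIsometricImmersion
    (hψ : g.IsIsometricImmersion g'.toPseudoRiemannianMetric ψ) (x : M) :
    (mfderiv (𝓡 d) (𝓡 d) ψ x).IsInvertible := by
  have key : ∀ u w : EuclideanSpace ℝ (Fin d),
      g'.val (ψ x) (mfderiv (𝓡 d) (𝓡 d) ψ x u) (mfderiv (𝓡 d) (𝓡 d) ψ x w) = g.val x u w :=
    fun u w ↦ DFunLike.congr_fun (DFunLike.congr_fun (hψ.2 x) u) w
  exact JetRigidity.isInvertible_of_bijective (F := EuclideanSpace ℝ (Fin d))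
    (G := EuclideanSpace ℝ (Fin d))
    (JetRigidity.bijective_of_map_eq (E := EuclideanSpace ℝ (Fin d))
      (F := EuclideanSpace ℝ (Fin d))
      (q₁ := (g.val x : EuclideanSpace ℝ (Fin d) →L[ℝ] EuclideanSpace ℝ (Fin d) →L[ℝ] ℝ))
      (q₂ := (g'.val (ψ x) : EuclideanSpace ℝ (Fin d) →L[ℝ] EuclideanSpace ℝ (Fin d) →L[ℝ] ℝ))
      (A := (mfderiv (𝓡 d) (𝓡 d) ψ x : EuclideanSpace ℝ (Fin d) →L[ℝ] EuclideanSpace ℝ (Fin d)))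
      rfl (g.nondegenerate x) key)

/-- **An isometric immersion between equidimensional Lorentzian manifolds is a local
diffeomorphism** (inverse function theorem on manifolds,
`Literature.Geometry.Manifold.isLocalDiffeomorphAt_of_mfderiv`, its differential being
invertible). O'Neill 1983, Ch. 3, p. 90 ("an isometric immersion of equidimensional manifolds is a
local isometry"). [cite: ONeillSemiRiemannian1983, Ch. 3, p. 90] -/
theorem isLocalDiffeomorph_of_isIsometricImmersion
    (hψ : g.IsIsometricImmersion g'.toPseudoRiemannianMetric ψ) :
    IsLocalDiffeomorph (𝓡 d) (𝓡 d) ∞ ψ := fun x ↦ by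
  obtain ⟨e, he⟩ := isInvertible_mfderiv_of_isIsometricImmersion hψ x
  exact Literature.Geometry.Manifold.isLocalDiffeomorphAt_of_mfderiv (by simp) isOpen_univ
    (mem_univ x) hψ.1.contMDiffOn e he.symm

variable (τ' : TimeOrientation g')

/-- The pulled-back orienting field `Y = ψ^* T'` (Mathlib's `VectorField.mpullback`) is mapped by
`dψ` to `T'`. [folklore] -/
theorem mfderiv_mpullback_vectorField
    (hψ : g.IsIsometricImmersion g'.toPseudoRiemannianMetric ψ) (x : M) :
    mfderiv (𝓡 d) (𝓡 d) ψ x (mpullback (𝓡 d) (𝓡 d) ψ τ'.vectorField x) =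
      τ'.vectorField (ψ x) := by
  rw [mpullback_apply]
  exact (((isInvertible_mfderiv_of_isIsometricImmersion hψ x).inverse_apply_eq).1 rfl).symm

/-- **The pulled-back orienting field is timelike**: `g(Y, Y) = g'(T', T') < 0`. [folklore] -/
theorem isTimelike_mpullback_vectorField
    (hψ : g.IsIsometricImmersion g'.toPseudoRiemannianMetric ψ) (x : M) :
    g.IsTimelike (mpullback (𝓡 d) (𝓡 d) ψ τ'.vectorField x) := by
  have h := DFunLike.congr_fun (DFunLike.congr_fun (hψ.2 x)
    (mpullback (𝓡 d) (𝓡 d) ψ τ'.vectorField x)) (mpullback (𝓡 d) (𝓡 d) ψ τ'.vectorField x)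
  rw [pullbackBilin_apply, mfderiv_mpullback_vectorField τ' hψ x] at h
  change g.val x _ _ < 0
  rw [← h]
  exact τ'.isTimelike (ψ x)

/-- **The pulled-back orienting field is `C¹`** (Mathlib's `ContMDiff.mpullback_vectorField`).
[folklore] -/
theorem contMDiff_mpullback_vectorField
    (hψ : g.IsIsometricImmersion g'.toPseudoRiemannianMetric ψ) :
    ContMDiff (𝓡 d) (𝓡 d).tangent 1 (fun x ↦
      (⟨x, mpullback (𝓡 d) (𝓡 d) ψ τ'.vectorField x⟩ : TangentBundle (𝓡 d) M)) :=
  ContMDiff.mpullback_vectorField (m := 1) (n := 2) (τ'.contMDiff.of_le (by simp))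
    (hψ.1.of_le (WithTop.coe_le_coe.mpr le_top : (2 : ℕ∞ω) ≤ ∞))
    (isInvertible_mfderiv_of_isIsometricImmersion hψ) (one_add_one_eq_two (R := ℕ∞ω)).le

/-- `ψ` maps integral curves of the pulled-back field `Y = ψ^* T'` to integral curves of `T'`
(chain rule, `dψ Y = T'`). [folklore] -/
theorem isMIntegralCurveAt_comp_of_mpullback
    (hψ : g.IsIsometricImmersion g'.toPseudoRiemannianMetric ψ) {γ : ℝ → M} {t : ℝ}
    (hγ : IsMIntegralCurveAt γ (mpullback (𝓡 d) (𝓡 d) ψ τ'.vectorField) t) :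
    IsMIntegralCurveAt (ψ ∘ γ) τ'.vectorField t := by
  have hψd : MDifferentiable (𝓡 d) (𝓡 d) ψ := hψ.1.mdifferentiable (by simp)
  filter_upwards [hγ] with s hs
  have hc := (hψd (γ s)).hasMFDerivAt.comp s hs
  have heq : (mfderiv (𝓡 d) (𝓡 d) ψ (γ s)).comp
      ((1 : ℝ →L[ℝ] ℝ).smulRight (mpullback (𝓡 d) (𝓡 d) ψ τ'.vectorField (γ s))) =
      (1 : ℝ →L[ℝ] ℝ).smulRight (τ'.vectorField ((ψ ∘ γ) s)) := by
    apply ContinuousLinearMap.ext_ring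
    change mfderiv (𝓡 d) (𝓡 d) ψ (γ s) ((1 : ℝ) • mpullback (𝓡 d) (𝓡 d) ψ τ'.vectorField (γ s)) =
      (1 : ℝ) • τ'.vectorField (ψ (γ s))
    rw [one_smul, one_smul]
    exact mfderiv_mpullback_vectorField τ' hψ (γ s)
  exact hc.congr_mfderiv heq

end LorentzianMetric

/-- **The pulled-back orienting field is future-directed** when `ψ` preserves the time
orientation: `g(T, Y) = g'(dψ T, T') < 0` because `dψ T` is future-directed for `τ'`.
O'Neill 1983, Ch. 5, p. 145. [cite: ONeillSemiRiemannian1983, Ch. 5, Lemma 26 ff. (p. 145)] -/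
theorem TimeOrientation.isFutureDirected_mpullback_vectorField (τ : TimeOrientation g)
    (τ' : TimeOrientation g') (hψ : g.IsIsometricImmersion g'.toPseudoRiemannianMetric ψ)
    (hτ : τ.PreservesTimeOrientation ψ τ') (x : M) :
    τ.IsFutureDirected (mpullback (𝓡 d) (𝓡 d) ψ τ'.vectorField x) := by
  have ht := LorentzianMetric.isTimelike_mpullback_vectorField τ' hψ x
  refine ⟨⟨le_of_lt ht, fun h0 ↦ ?_⟩, ?_⟩
  · have ht' : g.val x (mpullback (𝓡 d) (𝓡 d) ψ τ'.vectorField x)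
        (mpullback (𝓡 d) (𝓡 d) ψ τ'.vectorField x) < 0 := ht
    rw [h0, map_zero] at ht'
    exact (lt_irrefl (0 : ℝ)) ht'
  · have h := DFunLike.congr_fun (DFunLike.congr_fun (hψ.2 x) (τ.vectorField x))
      (mpullback (𝓡 d) (𝓡 d) ψ τ'.vectorField x)
    rw [pullbackBilin_apply, LorentzianMetric.mfderiv_mpullback_vectorField τ' hψ x] at h
    change g.val x _ _ < 0
    rw [← h, g'.symm]
    exact (hτ x).2

end Generic

/-! ### Lemma 9 for developments realised as open subsets -/

section Developments

variable {n : ℕ} {X : Type u} [TopologicalSpace X] [ChartedSpace (EuclideanSpace ℝ (Fin n)) X]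
  [IsManifold (𝓡 n) ∞ X] [ConnectedSpace X] {D : InitialDataSet (𝓡 n) X}

namespace CauchyDevelopment

/-- **Sbierski 2016, Lemma 9, for a development realised as an open subset: the isometric
immersion of a common globally hyperbolic development is injective.** Let `𝒟`, `𝒟'` be Cauchy
developments of `D`, `U ⊆ M` an open subset of the spacetime of `𝒟` containing `ι(X)` in which
`ι(X)` is a Cauchy hypersurface (for `g|_U`, `τ|_U`), and `ψ : U → M'` a time-orientation
preserving isometric immersion of the open sub-spacetime with `ψ ∘ ι = ι'`. Then `ψ` is
injective. Proof as in `CauchyDevelopment.injective_of_isIsometricImmersion`, on the manifold `U`: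
if `ψ p = ψ q`, the maximal integral curves `σ`, `γ` through `p`, `q` of the pulled-back orienting
field `Y = ψ^* T'` (endless timelike curves of `U`) are mapped by `ψ` to integral curves of `T'`
through one point, which glue to one timelike curve `κ` of `M'`; `γ`, `σ` cross `ι(X)` (the
Cauchy hypersurface of `U`) at parameters `τ₀`, `τ₁` where `κ` crosses `ι'(X)`, so `τ₀ = τ₁`
(a timelike curve of `M'` meets `ι'(X)` at most once), `γ τ₀ = σ τ₀` as `ψ ∘ ι = ι'` is injective,
whence `γ = σ` near `0` and `p = q`. *"Note that by Lemma 9 `ψ` is then automatically an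
isometric embedding"* (proof of Thm. 10). [cite: Sbierski2016AHP, §3.1, Lemma 9 (arXiv numbering) and proof of Thm. 10] -/
theorem injective_of_isIsometricImmersion_opens (𝒟 𝒟' : CauchyDevelopment D)
    {U : Opens 𝒟.carrier} (hι : ∀ x, 𝒟.embed x ∈ U)
    (hU : (𝒟.metric.restrict PseudoRiemannianMetric.contMDiff_restrict_holds U).IsCauchyHypersurface
      (𝒟.timeOrientation.restrict PseudoRiemannianMetric.contMDiff_restrict_holds
        𝒟.timeOrientation.contMDiff_restrict_holds U) (Subtype.val ⁻¹' range 𝒟.embed))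
    {ψ : U → 𝒟'.carrier}
    (hψ : (𝒟.metric.restrict PseudoRiemannianMetric.contMDiff_restrict_holds U).IsIsometricImmersion
      𝒟'.metric.toPseudoRiemannianMetric ψ)
    (hτ : (𝒟.timeOrientation.restrict PseudoRiemannianMetric.contMDiff_restrict_holds
      𝒟.timeOrientation.contMDiff_restrict_holds U).PreservesTimeOrientation ψ 𝒟'.timeOrientation)
    (hψι : ψ ∘ 𝒟.embedOpens U hι = 𝒟'.embed) : Injective ψ := by
  classical
  intro p q hpq
  have hn2 : (2 : ℕ∞ω) ≤ ∞ := WithTop.coe_le_coe.mpr le_top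
  set gU := 𝒟.metric.restrict PseudoRiemannianMetric.contMDiff_restrict_holds U with hgU
  set τU := 𝒟.timeOrientation.restrict PseudoRiemannianMetric.contMDiff_restrict_holds
    𝒟.timeOrientation.contMDiff_restrict_holds U with hτU
  set T' := 𝒟'.timeOrientation.vectorField with hT'def
  have hT' : ContMDiff (𝓡 (n + 1)) (𝓡 (n + 1)).tangent 1
      (fun x ↦ (⟨x, T' x⟩ : TangentBundle (𝓡 (n + 1)) 𝒟'.carrier)) :=
    𝒟'.timeOrientation.contMDiff.of_le (by simp)
  -- the pulled-back orienting field on `U`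
  set Y := mpullback (𝓡 (n + 1)) (𝓡 (n + 1)) ψ T' with hYdef
  have hY : ContMDiff (𝓡 (n + 1)) (𝓡 (n + 1)).tangent 1
      (fun x ↦ (⟨x, Y x⟩ : TangentBundle (𝓡 (n + 1)) U)) :=
    LorentzianMetric.contMDiff_mpullback_vectorField 𝒟'.timeOrientation hψ
  have hYt : ∀ x, gU.IsTimelike (Y x) :=
    LorentzianMetric.isTimelike_mpullback_vectorField 𝒟'.timeOrientation hψ
  have hYf : ∀ x, τU.IsFutureDirected (Y x) :=
    TimeOrientation.isFutureDirected_mpullback_vectorField τU 𝒟'.timeOrientation hψ hτ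
  -- maximal integral curves of `Y` through `q` and `p`
  obtain ⟨γ, Dγ, hγ, hDγo, h0γ, hγ0, hγint⟩ :=
    gU.exists_isEndlessTimelikeCurve_isMIntegralCurveAt τU hY hYt hYf q
  obtain ⟨σ, Dσ, hσ, hDσo, h0σ, hσ0, hσint⟩ :=
    gU.exists_isEndlessTimelikeCurve_isMIntegralCurveAt τU hY hYt hYf p
  -- their images are integral curves of `T'` through `ψ q = ψ p`, hence agree on `Dγ ∩ Dσ`
  have hγ' : ∀ t ∈ Dγ, IsMIntegralCurveAt (ψ ∘ γ) T' t := fun t ht ↦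
    LorentzianMetric.isMIntegralCurveAt_comp_of_mpullback 𝒟'.timeOrientation hψ (hγint t ht)
  have hσ' : ∀ t ∈ Dσ, IsMIntegralCurveAt (ψ ∘ σ) T' t := fun t ht ↦
    LorentzianMetric.isMIntegralCurveAt_comp_of_mpullback 𝒟'.timeOrientation hψ (hσint t ht)
  have hagree : EqOn (ψ ∘ γ) (ψ ∘ σ) (Dγ ∩ Dσ) :=
    IntegralCurve.eqOn_of_isOpen_ordConnected hT' (hDγo.inter hDσo) (hγ.1.inter hσ.1)
      (fun t ht ↦ hγ' t ht.1) (fun t ht ↦ hσ' t ht.2) ⟨h0γ, h0σ⟩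
      (by simp only [comp_apply, hγ0, hσ0, hpq])
  -- the glued curve `κ` of `M'`
  set κ : ℝ → 𝒟'.carrier := fun t ↦ if t ∈ Dγ then ψ (γ t) else ψ (σ t) with hκ
  have hκγ : ∀ t ∈ Dγ, κ t = ψ (γ t) := fun t ht ↦ by simp only [hκ, if_pos ht]
  have hκσ : ∀ t ∈ Dσ, κ t = ψ (σ t) := fun t ht ↦ by
    by_cases h : t ∈ Dγ
    · rw [hκγ t h]; exact hagree ⟨h, ht⟩
    · simp only [hκ, if_neg h]
  have hκγ' : ∀ t ∈ Dγ, κ =ᶠ[𝓝 t] (ψ ∘ γ) := fun t ht ↦ by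
    filter_upwards [hDγo.mem_nhds ht] with t' ht'
    exact hκγ t' ht'
  have hκσ' : ∀ t ∈ Dσ, κ =ᶠ[𝓝 t] (ψ ∘ σ) := fun t ht ↦ by
    filter_upwards [hDσo.mem_nhds ht] with t' ht'
    exact hκσ t' ht'
  have hκint : ∀ t ∈ Dγ ∪ Dσ, IsMIntegralCurveAt κ T' t := by
    rintro t (ht | ht)
    · exact IntegralCurve.isMIntegralCurveAt_congr (hγ' t ht) (hκγ' t ht)
    · exact IntegralCurve.isMIntegralCurveAt_congr (hσ' t ht) (hκσ' t ht)
  have hκt : 𝒟'.metric.IsFutureTimelikeCurveOn 𝒟'.timeOrientation κ (Dγ ∪ Dσ) := fun t ht ↦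
    LorentzianMetric.futureTimelikeAt_of_hasMFDerivAt rfl (hκint t ht).hasMFDerivAt
      (𝒟'.timeOrientation.isTimelike _) (𝒟'.timeOrientation.isFutureDirected_vectorField _)
  have hord : (Dγ ∪ Dσ).OrdConnected :=
    isPreconnected_iff_ordConnected.1 ((isPreconnected_iff_ordConnected.2 hγ.1).union 0 h0γ h0σ
      (isPreconnected_iff_ordConnected.2 hσ.1))
  -- the crossings of the Cauchy hypersurfaces
  obtain ⟨τ₀, ⟨hτ₀D, x₀, hx₀⟩, -⟩ := hU γ Dγ hγ
  obtain ⟨τ₁, ⟨hτ₁D, x₁, hx₁⟩, -⟩ := hU σ Dσ hσ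
  have hγτ₀ : γ τ₀ = 𝒟.embedOpens U hι x₀ := Subtype.ext hx₀.symm
  have hστ₁ : σ τ₁ = 𝒟.embedOpens U hι x₁ := Subtype.ext hx₁.symm
  have hκ₀ : κ τ₀ = 𝒟'.embed x₀ := by
    rw [hκγ τ₀ hτ₀D, hγτ₀]; exact congr_fun hψι x₀
  have hκ₁ : κ τ₁ = 𝒟'.embed x₁ := by
    rw [hκσ τ₁ hτ₁D, hστ₁]; exact congr_fun hψι x₁
  have h01 : τ₀ = τ₁ :=
    LorentzianMetric.IsCauchyHypersurface.eq_of_mem_of_mem hn2 𝒟'.isCauchyHypersurface hord hκt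
      (Or.inl hτ₀D) (Or.inr hτ₁D) ⟨x₀, hκ₀.symm⟩ ⟨x₁, hκ₁.symm⟩
  subst h01
  -- `γ τ₀ = σ τ₀`, as `ψ ∘ ι = ι'` is injective
  have hx : x₀ = x₁ := 𝒟'.isSmoothEmbedding.isEmbedding.injective (hκ₀.symm.trans hκ₁)
  have hγσ : γ τ₀ = σ τ₀ := by rw [hγτ₀, hστ₁, hx]
  -- uniqueness of integral curves of `Y`: `γ = σ` on `Dγ ∩ Dσ ∋ 0`
  have heq := IntegralCurve.eqOn_of_isOpen_ordConnected hY (hDγo.inter hDσo) (hγ.1.inter hσ.1)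
    (fun t ht ↦ hγint t ht.1) (fun t ht ↦ hσint t ht.2) ⟨hτ₀D, hτ₁D⟩ hγσ ⟨h0γ, h0σ⟩
  rw [hγ0, hσ0] at heq
  exact heq.symm

/-- **The isometric immersion of a common globally hyperbolic development is an open
embedding** (Sbierski 2016, Lemma 9 with the remark after Def. 2.3, for developments realised as
open subsets): it is injective (`injective_of_isIsometricImmersion_opens`) and a local
diffeomorphism (`LorentzianMetric.isLocalDiffeomorph_of_isIsometricImmersion`), hence an open
topological embedding. [cite: Sbierski2016AHP, §3.1, Lemma 9 (arXiv numbering)] -/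
theorem isOpenEmbedding_of_isIsometricImmersion_opens (𝒟 𝒟' : CauchyDevelopment D)
    {U : Opens 𝒟.carrier} (hι : ∀ x, 𝒟.embed x ∈ U)
    (hU : (𝒟.metric.restrict PseudoRiemannianMetric.contMDiff_restrict_holds U).IsCauchyHypersurface
      (𝒟.timeOrientation.restrict PseudoRiemannianMetric.contMDiff_restrict_holds
        𝒟.timeOrientation.contMDiff_restrict_holds U) (Subtype.val ⁻¹' range 𝒟.embed))
    {ψ : U → 𝒟'.carrier}
    (hψ : (𝒟.metric.restrict PseudoRiemannianMetric.contMDiff_restrict_holds U).IsIsometricImmersion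
      𝒟'.metric.toPseudoRiemannianMetric ψ)
    (hτ : (𝒟.timeOrientation.restrict PseudoRiemannianMetric.contMDiff_restrict_holds
      𝒟.timeOrientation.contMDiff_restrict_holds U).PreservesTimeOrientation ψ 𝒟'.timeOrientation)
    (hψι : ψ ∘ 𝒟.embedOpens U hι = 𝒟'.embed) : IsOpenEmbedding ψ :=
  IsOpenEmbedding.of_continuous_injective_isOpenMap hψ.1.continuous
    (injective_of_isIsometricImmersion_opens 𝒟 𝒟' hι hU hψ hτ hψι)
    (LorentzianMetric.isLocalDiffeomorph_of_isIsometricImmersion hψ).isLocalHomeomorph.isOpenMap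

end CauchyDevelopment

end Developments

end Literature.Geometry.Lorentzian

end
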